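import Mathlib
import Literature.MathematicalPhysics.KineticTheory.FouriersLaw
import Literature.MathematicalPhysics.KineticTheory.ZeroWavenumberSpace
import Literature.MathematicalPhysics.KineticTheory.FluctuationAbelPositivity
import Summits.AtomisticToContinuum.FouriersLaw.Theorems.EmbeddedDrudeMourreAbelOfSpectralDensity
import HarnessLib

/-!
# `EmbeddedDrudeMourre.MourreDissolution`, line `separable-vertex-faddeev-pair-sector` —
# helpers for stub `stub_fgrPositivity` (part 3/4): the Abel integrand is honest; spectral floor

Item `stmt-AtomisticToContinuum-12594` (crux `MourreDissolution` of route `EmbeddedDrudeMourre`,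
sub-problem `FouriersLaw`), registered stub `stub_fgrPositivity` (S7) of the line skeleton
`Cruxes/MourreDissolution/Lines/separable_vertex_faddeev_pair_sector.lean`, whose conclusion is a
uniform floor of the Bochner integral `A_μ(ν) = ∫₀^∞ e^{-νt} C_μ(t) dt`,
`C_μ = InfiniteChainDynamics.currentCorrelation` (summed current autocorrelation of the chain).

§1 (junk audit of the stub, NO strong continuity of the Koopman group, NO superstability, NO
clustering): for every oscillator chain with `V ∈ C¹` and every `μ`-preserving dynamics,
`t ↦ C_μ(t)` is MEASURABLE (`measurable_currentCorrelation`: on a measurable co-null part of the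
carrier the integrand `j₀(σ) j_x(φ_t σ)` is a Carathéodory function — continuous in `t` because
orbits solve the equations of motion, measurable in `σ` — hence jointly measurable
(`measurable_uncurry_of_continuous_of_measurable`); partial Bochner integrals are measurable
(`StronglyMeasurable.integral_prod_right'`); countable sums (`Measurable.tsum`)); under momentum
reversal `|C_μ(t)| ≤ C_μ(0) = ‖[J]‖₀²` (`abs_currentCorrelation_le`, `U_t` is an isometry of `ℋ₀`).
Hence for the pinned chain (`V'(r) = r + βr³`) the Abel integrand of Stub 7 is INTEGRABLE under the
stub's own hypotheses (`integrableOn_exp_neg_mul_currentCorrelation_pinnedChain`, the headline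
`abelIntegrand_integrable_pinnedChain`): the registered conclusion is never about the junk value `0`
of a non-integrable integrand; and `A_μ(ν) ≤ C_μ(0)/ν`.

§2 (spectral form of the floor, given the cosine-Bochner representation `C = ∫ cos(ωt) dσ` of
Stub 2): `ν/(ν² + a²)·σ([-a,a]) ≤ A(ν) = ∫ ν/(ν² + ω²) dσ(ω)` (Poisson kernel, tree:
`AbelOfSpectralDensity.integral_exp_neg_mul_cosTransform`), in particular
`σ([-ν,ν])/(2ν) ≤ A(ν)`: a uniform Abel floor follows from "no pseudogap at frequency 0",
`σ([-ν,ν]) ≥ 2cν` for small `ν`. All proofs tagged `[folklore]`.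
-/

noncomputable section

namespace Summit.AtomisticToContinuum.FouriersLaw.Theorems.MourreDissolution

open Filter Topology MeasureTheory Set
open scoped InnerProductSpace
open Literature.MathematicalPhysics.KineticTheory.HeatConduction
open Literature.MathematicalPhysics.KineticTheory

/-! ### §1. The Abel integrand of the stub is honest (no strong continuity needed) -/

section AbelIntegrand

variable {P : OscillatorChain}

/-- Orbits are continuous in time, coordinatewise, on the carrier (they solve the equations of
motion). [folklore] -/
-- adapted from Literature/MathematicalPhysics/KineticTheory/InfiniteChainCorrelationContinuity.lean
-- (`InfiniteChainDynamics.continuous_flow_apply`), restated to keep this file's imports light.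
theorem continuous_flow_apply (D : InfiniteChainDynamics P) {σ : ChainConfig} (hσ : σ ∈ D.carrier)
    (i : ℤ) : Continuous fun t : ℝ => D.flow t σ i := by
  have hsol := D.isSolution σ hσ
  have h1 : Continuous fun t : ℝ => (D.flow t σ i).1 :=
    continuous_iff_continuousAt.2 fun t => (hsol i t).1.continuousAt
  have h2 : Continuous fun t : ℝ => (D.flow t σ i).2 :=
    continuous_iff_continuousAt.2 fun t => (hsol i t).2.continuousAt
  exact h1.prodMk h2

/-- The bond current along an orbit in the carrier is continuous in time (`V'` continuous).
[folklore] -/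
-- adapted from `InfiniteChainDynamics.continuous_bondCurrentZ_flow` (same file as above).
theorem continuous_bondCurrentZ_flow (hVc : Continuous (deriv P.V)) (D : InfiniteChainDynamics P)
    {σ : ChainConfig} (hσ : σ ∈ D.carrier) (x : ℤ) :
    Continuous fun t : ℝ => P.bondCurrentZ (D.flow t σ) x := by
  have hq : ∀ i : ℤ, Continuous fun t : ℝ => (D.flow t σ i).1 := fun i =>
    continuous_fst.comp (continuous_flow_apply D hσ i)
  have hp : ∀ i : ℤ, Continuous fun t : ℝ => (D.flow t σ i).2 := fun i =>
    continuous_snd.comp (continuous_flow_apply D hσ i)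
  unfold OscillatorChain.bondCurrentZ
  exact ((((hp x).add (hp (x + 1))).div_const 2).mul (hVc.comp ((hq (x + 1)).sub (hq x)))).neg

/-- **`t ↦ ∫ j_y (j_x ∘ φ_t) dμ` is measurable** for every dynamics preserving `μ` (carrier co-null,
each `φ_t` measurable) and `V ∈ C¹` — with NO moment, superstability or continuity hypothesis on
the state: on a measurable co-null subset of the carrier the integrand is a Carathéodory function
(continuous in `t`, measurable in `σ`), hence jointly measurable
(`measurable_uncurry_of_continuous_of_measurable`), and partial Bochner integrals of jointly
measurable functions are measurable (`StronglyMeasurable.integral_prod_right'`). [folklore] -/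
theorem measurable_integral_bondCurrentZ_mul_flow (hVc : Continuous (deriv P.V))
    (D : InfiniteChainDynamics P) {μ : Measure ChainConfig} [SFinite μ] (hμ : D.PreservesMeasure μ)
    (x y : ℤ) :
    Measurable fun t : ℝ => ∫ σ, P.bondCurrentZ σ y * P.bondCurrentZ (D.flow t σ) x ∂μ := by
  -- a measurable co-null subset `S` of the carrier
  obtain ⟨N, hNsup, hNmeas, hN0⟩ := exists_measurable_superset_of_null (ae_iff.1 hμ.1)
  set S : Set ChainConfig := Nᶜ with hSdef
  have hS : S ⊆ D.carrier := fun σ hσ => by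
    by_contra h
    exact hσ (hNsup h)
  have hSae : ∀ᵐ σ ∂μ, σ ∈ S := by
    rw [hSdef]
    exact measure_eq_zero_iff_ae_notMem.1 hN0
  -- the Carathéodory modification of the integrand
  set g : ℝ → ChainConfig → ℝ := fun t σ =>
    S.indicator (fun σ => P.bondCurrentZ σ y * P.bondCurrentZ (D.flow t σ) x) σ with hg
  have hg_cont : ∀ σ : ChainConfig, Continuous fun t : ℝ => g t σ := by
    intro σ
    by_cases hσ : σ ∈ S
    · simp only [hg, indicator_of_mem hσ]
      exact continuous_const.mul (continuous_bondCurrentZ_flow hVc D (hS hσ) x)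
    · simp only [hg, indicator_of_notMem hσ]
      exact continuous_const
  have hj : ∀ z : ℤ, Measurable fun σ : ChainConfig => P.bondCurrentZ σ z := by
    intro z
    have hq : ∀ w : ℤ, Measurable fun σ : ChainConfig => (σ w).1 := fun w =>
      (measurable_pi_apply w).fst
    have hp : ∀ w : ℤ, Measurable fun σ : ChainConfig => (σ w).2 := fun w =>
      (measurable_pi_apply w).snd
    unfold OscillatorChain.bondCurrentZ
    exact ((((hp z).add (hp (z + 1))).div_const 2).mul
      (hVc.measurable.comp ((hq (z + 1)).sub (hq z)))).neg
  have hg_meas : ∀ t : ℝ, Measurable (g t) := fun t =>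
    ((hj y).mul ((hj x).comp (hμ.2 t).measurable)).indicator hNmeas.compl
  have hjoint : Measurable (Function.uncurry g) :=
    measurable_uncurry_of_continuous_of_measurable hg_cont hg_meas
  have h1 : Measurable fun t : ℝ => ∫ σ, g t σ ∂μ :=
    (hjoint.stronglyMeasurable.integral_prod_right' (ν := μ)).measurable
  have heq : (fun t : ℝ => ∫ σ, g t σ ∂μ) =
      fun t : ℝ => ∫ σ, P.bondCurrentZ σ y * P.bondCurrentZ (D.flow t σ) x ∂μ := by
    funext t
    refine integral_congr_ae ?_
    filter_upwards [hSae] with σ hσ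
    simp only [hg, indicator_of_mem hσ]
  rw [heq] at h1
  exact h1

/-- **`t ↦ C_μ(t)` is measurable** (`V ∈ C¹`, `μ` preserved by `D`): a countable `tsum` of measurable
functions (`Measurable.tsum`). No strong continuity of the Koopman group, no clustering. [folklore] -/
theorem measurable_currentCorrelation (hVc : Continuous (deriv P.V)) (D : InfiniteChainDynamics P)
    {μ : Measure ChainConfig} [SFinite μ] (hμ : D.PreservesMeasure μ) :
    Measurable (D.currentCorrelation μ) := by
  have h : D.currentCorrelation μ = fun t : ℝ => ∑' x : ℤ,
      (fun (x : ℤ) (t : ℝ) => ∫ σ, P.bondCurrentZ σ 0 * P.bondCurrentZ (D.flow t σ) x ∂μ) x t := rfl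
  rw [h]
  exact Measurable.tsum fun x => measurable_integral_bondCurrentZ_mul_flow hVc D hμ x 0

/-- `V'(r) = r + βr³` for `pinnedChain`, so `V'` is continuous. [folklore] -/
theorem continuous_deriv_pinnedChain_V (ω₂ lam β γ : ℝ) :
    Continuous (deriv (pinnedChain ω₂ lam β γ).V) := by
  have hd : ∀ r : ℝ, HasDerivAt (pinnedChain ω₂ lam β γ).V (r + β * r ^ 3) r := by
    intro r
    have h : HasDerivAt (fun r : ℝ => r ^ 2 / 2 + β * r ^ 4 / 4)
        ((2 * r ^ 1 * 1) / 2 + β * (4 * r ^ 3 * 1) / 4) r :=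
      (((hasDerivAt_id r).pow 2).div_const 2).add
        ((((hasDerivAt_id r).pow 4).const_mul β).div_const 4)
    have e : (2 * r ^ 1 * 1) / 2 + β * (4 * r ^ 3 * 1) / 4 = r + β * r ^ 3 := by ring
    rw [e] at h
    exact h
  have hderiv : deriv (pinnedChain ω₂ lam β γ).V = fun r => r + β * r ^ 3 :=
    funext fun r => (hd r).deriv
  rw [hderiv]
  fun_prop

variable {D : InfiniteChainDynamics P}

/-- **`|C_μ(t)| ≤ C_μ(0)`** under momentum reversal (`C_μ(t) = ⟪[J], U_t[J]⟫₀`, `U_t` an isometry,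
`C_μ(0) = ‖[J]‖₀²`). [folklore] -/
theorem _root_.Literature.MathematicalPhysics.KineticTheory.HeatConduction.ZeroWavenumberData.abs_currentCorrelation_le
    (Z : ZeroWavenumberData P D) (hRev : Z.HasMomentumReversal) (t : ℝ) :
    |D.currentCorrelation Z.μ t| ≤ D.currentCorrelation Z.μ 0 := by
  rw [← Z.inner_currentClass_koopman_eq_currentCorrelation' hRev t,
    Z.currentCorrelation_zero_eq_norm_sq (Z.integral_bondCurrent_eq_zero hRev)]
  calc |⟪Z.currentClass, Z.koopman t Z.currentClass⟫_ℝ|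
      ≤ ‖Z.currentClass‖ * ‖Z.koopman t Z.currentClass‖ := abs_real_inner_le_norm _ _
    _ = ‖Z.currentClass‖ ^ 2 := by rw [LinearIsometryEquiv.norm_map, sq]

/-- **The Abel integrand is integrable WITHOUT strong continuity**: for zero-wavenumber data with
momentum reversal of a chain with `V ∈ C¹`, `t ↦ e^{-νt} C_μ(t) ∈ L¹(0, ∞)` for every `ν > 0`
(measurable by `measurable_currentCorrelation`, bounded by `C_μ(0)`). [folklore] -/
theorem _root_.Literature.MathematicalPhysics.KineticTheory.HeatConduction.ZeroWavenumberData.integrableOn_exp_neg_mul_currentCorrelation'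
    (Z : ZeroWavenumberData P D) (hVc : Continuous (deriv P.V)) (hRev : Z.HasMomentumReversal)
    {ν : ℝ} (hν : 0 < ν) :
    IntegrableOn (fun t : ℝ => Real.exp (-(ν * t)) * D.currentCorrelation Z.μ t) (Ioi 0) := by
  have hmeas := measurable_currentCorrelation hVc D Z.preservesMeasure
  refine Integrable.mono' ((exp_neg_integrableOn_Ioi 0 hν).const_mul (D.currentCorrelation Z.μ 0))
    ?_ (ae_of_all _ fun t => ?_)
  · exact ((Real.continuous_exp.comp (continuous_const.mul continuous_id).neg).measurable.mul
      hmeas).aestronglyMeasurable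
  · rw [norm_mul, Real.norm_of_nonneg (Real.exp_pos _).le, Real.norm_eq_abs, neg_mul]
    calc Real.exp (-(ν * t)) * |D.currentCorrelation Z.μ t|
        ≤ Real.exp (-(ν * t)) * D.currentCorrelation Z.μ 0 :=
          mul_le_mul_of_nonneg_left (Z.abs_currentCorrelation_le hRev t) (Real.exp_pos _).le
      _ = D.currentCorrelation Z.μ 0 * Real.exp (-(ν * t)) := mul_comm _ _

/-- **The Abel integrand of Stub 7 is integrable under the stub's own hypotheses** (in fact under
fewer: any zero-wavenumber data of `pinnedChain ω₂ lam β γ` with momentum reversal, any parameters,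
NO superstability, NO strong continuity): the Bochner integral in the stub's conclusion is never the
junk value `0` of a non-integrable integrand, so the registered statement is an honest assertion
about `∫₀^∞ e^{-νt} C_T(t) dt`. [folklore] -/
theorem _root_.Literature.MathematicalPhysics.KineticTheory.HeatConduction.ZeroWavenumberData.integrableOn_exp_neg_mul_currentCorrelation_pinnedChain
    {ω₂ lam β γ : ℝ} {D : InfiniteChainDynamics (pinnedChain ω₂ lam β γ)}
    (Z : ZeroWavenumberData (pinnedChain ω₂ lam β γ) D) (hRev : Z.HasMomentumReversal) {ν : ℝ}
    (hν : 0 < ν) :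
    IntegrableOn (fun t : ℝ => Real.exp (-(ν * t)) * D.currentCorrelation Z.μ t) (Ioi 0) :=
  Z.integrableOn_exp_neg_mul_currentCorrelation' (continuous_deriv_pinnedChain_V ω₂ lam β γ) hRev hν

/-- The Abel functional is bounded above by `C_μ(0)/ν` (chain with `V ∈ C¹`, momentum reversal; no
strong continuity). [folklore] -/
theorem _root_.Literature.MathematicalPhysics.KineticTheory.HeatConduction.ZeroWavenumberData.abelFunctional_le_currentCorrelation_zero_div
    (Z : ZeroWavenumberData P D) (hVc : Continuous (deriv P.V)) (hRev : Z.HasMomentumReversal)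
    {ν : ℝ} (hν : 0 < ν) :
    ∫ t in Ioi (0 : ℝ), Real.exp (-(ν * t)) * D.currentCorrelation Z.μ t ≤
      D.currentCorrelation Z.μ 0 / ν := by
  have hint := Z.integrableOn_exp_neg_mul_currentCorrelation' hVc hRev hν
  have hexp : IntegrableOn (fun t : ℝ => D.currentCorrelation Z.μ 0 * Real.exp (-(ν * t)))
      (Ioi 0) := by
    have h : IntegrableOn (fun t : ℝ => D.currentCorrelation Z.μ 0 * Real.exp (-ν * t)) (Ioi 0) :=
      (exp_neg_integrableOn_Ioi 0 hν).const_mul (D.currentCorrelation Z.μ 0)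
    refine IntegrableOn.congr_fun h (fun t _ => ?_) measurableSet_Ioi
    simp only [neg_mul]
  calc ∫ t in Ioi (0 : ℝ), Real.exp (-(ν * t)) * D.currentCorrelation Z.μ t
      ≤ ∫ t in Ioi (0 : ℝ), D.currentCorrelation Z.μ 0 * Real.exp (-(ν * t)) := by
        refine setIntegral_mono_on hint hexp measurableSet_Ioi fun t _ => ?_
        calc Real.exp (-(ν * t)) * D.currentCorrelation Z.μ t
            ≤ Real.exp (-(ν * t)) * D.currentCorrelation Z.μ 0 :=
              mul_le_mul_of_nonneg_left (le_of_abs_le (Z.abs_currentCorrelation_le hRev t))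
                (Real.exp_pos _).le
          _ = D.currentCorrelation Z.μ 0 * Real.exp (-(ν * t)) := mul_comm _ _
    _ = D.currentCorrelation Z.μ 0 / ν := by
        rw [integral_const_mul]
        have h : ∫ t in Ioi (0 : ℝ), Real.exp (-(ν * t)) = 1 / ν := by
          have h' := integral_exp_mul_Ioi (neg_neg_of_pos hν) 0
          rw [mul_zero, Real.exp_zero] at h'
          refine (setIntegral_congr_fun measurableSet_Ioi (fun t _ => ?_)).trans (h'.trans ?_)
          · simp only [neg_mul]
          · field_simp
        rw [h]
        ring

/-- **Headline of this file (registered helper stub of `stmt-AtomisticToContinuum-12594`): the Abel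
integrand of Stub 7 is integrable** — for every zero-wavenumber datum of `pinnedChain ω₂ lam β γ`
(any parameters) with momentum reversal and every `ν > 0`, `t ↦ e^{-νt} C_μ(t) ∈ L¹(0, ∞)`; no
strong continuity, superstability, Gibbs property or clustering is used. [folklore] -/
theorem abelIntegrand_integrable_pinnedChain :
    ∀ (ω₂ lam β γ : ℝ)
      (D : Literature.MathematicalPhysics.KineticTheory.HeatConduction.InfiniteChainDynamics
        (Literature.MathematicalPhysics.KineticTheory.HeatConduction.pinnedChain ω₂ lam β γ))
      (Z : Literature.MathematicalPhysics.KineticTheory.HeatConduction.ZeroWavenumberData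
        (Literature.MathematicalPhysics.KineticTheory.HeatConduction.pinnedChain ω₂ lam β γ) D),
      Z.HasMomentumReversal → ∀ ν : ℝ, 0 < ν →
        MeasureTheory.IntegrableOn (fun t : ℝ => Real.exp (-(ν * t)) * D.currentCorrelation Z.μ t)
          (Set.Ioi (0:ℝ)) MeasureTheory.volume := by
  intro ω₂ lam β γ D Z hRev ν hν
  exact Z.integrableOn_exp_neg_mul_currentCorrelation_pinnedChain hRev hν

end AbelIntegrand

/-! ### §2. Spectral form of the Abel floor ("no pseudogap at frequency 0") -/

section Spectral

/-- **Spectral form of the Abel floor**: if `C(t) = ∫ cos(ωt) dσ(ω)` for a finite measure `σ`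
(the current spectral measure delivered by the cosine-Bochner stub), then for `ν > 0` and any `a`
`ν/(ν² + a²) · σ([-a, a]) ≤ ∫₀^∞ e^{-νt} C(t) dt = ∫ ν/(ν² + ω²) dσ(ω)`
(the Poisson kernel is `≥ ν/(ν² + a²)` on `[-a, a]` and `≥ 0` elsewhere). With `a = ν`:
`σ([-ν, ν])/(2ν) ≤ A(ν)`, so a uniform Abel floor follows from the lower bound
`σ([-ν, ν]) ≥ 2cν` on the spectral mass of the current at the origin. [folklore] -/
theorem poisson_mul_measureReal_Icc_le_abelFunctional (σ : Measure ℝ) [IsFiniteMeasure σ]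
    (C : ℝ → ℝ) (hC : ∀ t : ℝ, C t = ∫ ω, Real.cos (ω * t) ∂σ) {ν : ℝ} (hν : 0 < ν) (a : ℝ) :
    ν / (ν ^ 2 + a ^ 2) * σ.real (Icc (-a) a) ≤
      ∫ t in Ioi (0 : ℝ), Real.exp (-(ν * t)) * C t := by
  have hC' : (fun t => Real.exp (-(ν * t)) * C t) =
      fun t => Real.exp (-(ν * t)) * ∫ ω, Real.cos (ω * t) ∂σ := by
    funext t; rw [hC t]
  rw [hC', AbelOfSpectralDensity.integral_exp_neg_mul_cosTransform σ hν]
  have hk_nonneg : ∀ ω : ℝ, 0 ≤ ν / (ν ^ 2 + ω ^ 2) := fun ω => by positivity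
  have hk_le : ∀ ω : ℝ, ν / (ν ^ 2 + ω ^ 2) ≤ ν⁻¹ := fun ω => by
    rw [div_le_iff₀ (by positivity)]
    have h1 : ν⁻¹ * (ν ^ 2 + ω ^ 2) = ν + ν⁻¹ * ω ^ 2 := by field_simp
    rw [h1]
    nlinarith [sq_nonneg ω, inv_pos.2 hν]
  have hmeas : Measurable fun ω : ℝ => ν / (ν ^ 2 + ω ^ 2) :=
    measurable_const.div (measurable_const.add (measurable_id.pow_const 2))
  have hint : Integrable (fun ω : ℝ => ν / (ν ^ 2 + ω ^ 2)) σ := by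
    refine Integrable.mono' (integrable_const ν⁻¹) hmeas.aestronglyMeasurable
      (ae_of_all _ fun ω => ?_)
    rw [Real.norm_eq_abs, abs_of_nonneg (hk_nonneg ω)]
    exact hk_le ω
  calc ν / (ν ^ 2 + a ^ 2) * σ.real (Icc (-a) a)
      = ∫ _ in Icc (-a) a, ν / (ν ^ 2 + a ^ 2) ∂σ := by
        rw [setIntegral_const, smul_eq_mul, mul_comm]
    _ ≤ ∫ ω in Icc (-a) a, ν / (ν ^ 2 + ω ^ 2) ∂σ := by
        refine setIntegral_mono_on (integrable_const _).integrableOn hint.integrableOn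
          measurableSet_Icc fun ω hω => ?_
        have hω : ω ^ 2 ≤ a ^ 2 := sq_le_sq' (by linarith [hω.1]) hω.2
        exact div_le_div_of_nonneg_left hν.le (by positivity) (by linarith)
    _ ≤ ∫ ω, ν / (ν ^ 2 + ω ^ 2) ∂σ := setIntegral_le_integral hint (ae_of_all _ hk_nonneg)

/-- The case `a = ν`: `σ([-ν, ν])/(2ν) ≤ ∫₀^∞ e^{-νt} C(t) dt`. [folklore] -/
theorem measureReal_Icc_div_le_abelFunctional (σ : Measure ℝ) [IsFiniteMeasure σ]
    (C : ℝ → ℝ) (hC : ∀ t : ℝ, C t = ∫ ω, Real.cos (ω * t) ∂σ) {ν : ℝ} (hν : 0 < ν) :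
    σ.real (Icc (-ν) ν) / (2 * ν) ≤ ∫ t in Ioi (0 : ℝ), Real.exp (-(ν * t)) * C t := by
  have h := poisson_mul_measureReal_Icc_le_abelFunctional σ C hC hν ν
  have e : ν / (ν ^ 2 + ν ^ 2) * σ.real (Icc (-ν) ν) = σ.real (Icc (-ν) ν) / (2 * ν) := by
    field_simp
    ring
  rwa [e] at h

/-- **A uniform Abel floor from a lower spectral density at the origin**: if `C = ∫ cos(ωt) dσ` and
`σ([-ν, ν]) ≥ 2cν` for `ν ∈ (0, ν₀)`, then `c ≤ ∫₀^∞ e^{-νt} C(t) dt` on `(0, ν₀)`. [folklore] -/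
theorem abelFunctional_floor_of_spectralMass (σ : Measure ℝ) [IsFiniteMeasure σ]
    (C : ℝ → ℝ) (hC : ∀ t : ℝ, C t = ∫ ω, Real.cos (ω * t) ∂σ) {c ν₀ : ℝ}
    (hmass : ∀ ν : ℝ, 0 < ν → ν < ν₀ → 2 * c * ν ≤ σ.real (Icc (-ν) ν)) :
    ∀ ν : ℝ, 0 < ν → ν < ν₀ → c ≤ ∫ t in Ioi (0 : ℝ), Real.exp (-(ν * t)) * C t := by
  intro ν hν hν₀
  refine le_trans ?_ (measureReal_Icc_div_le_abelFunctional σ C hC hν)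
  rw [le_div_iff₀ (by positivity)]
  linarith [hmass ν hν hν₀]

end Spectral

end Summit.AtomisticToContinuum.FouriersLaw.Theorems.MourreDissolution

end
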